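import Literature.MathematicalPhysics.QuantumLattice.SpinFlippedStatesStaggeredOrderCoexistence
import Literature.MathematicalPhysics.QuantumLattice.VariationalEquilibriumCoexistence
import Literature.MathematicalPhysics.QuantumLattice.FermionGibbsVariationalPrinciple
import HarnessLib

/-!
# The pressure is even in a uniform magnetic field; the bound on spontaneous (ferro)magnetisation of
# translation-invariant equilibrium states of the Hubbard and `t–t'` Hubbard models

Uniform-field twin of `StaggeredMagnetisationSpinFlipBound` / `SpinFlippedStatesStaggeredOrderCoexistence` for the translation-invariant
variational principle (`IsVarEquilibrium`, `varPressure = freePressure`):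

* §1 the spin exchange on mean-energy observables and mean energies: `E_{Ψ^swap} = Γ_swap E_Ψ`, `e_Ψ(ω ∘ Γ) = e_{Ψ^swap}(ω)`, `Ψ^swap^swap = Ψ`;
  the spin-imbalance direction is ODD (`relabel_spinSwap_spinImbalanceInteraction`), so the spin polarisation `e_s(ω) = ρ_↑ − ρ_↓` is odd
  under `ω ↦ ω ∘ Γ`; the diagonal (`t'`) hopping and the `t–t'` Hubbard interaction are invariant.
* §2 **translation-invariant equilibrium states go to equilibrium states**: `IsVarEquilibrium.spinFlip` (`ω ↦ ω ∘ Γ`, `Ψ ↦ Ψ^swap`).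
* §3 the models `hubbardZeeman d t U θ = Φ^{t,U} + θ₀ n + θ₁ s` (any `d`) and `gcInteractionTT' t t' U μ h` (`ℤ²`): spin exchange reverses the
  field, **`P(β; θ₀, −θ₁) = P(β; θ₀, θ₁)`**, `P(β; t,t',U,μ,−h) = P(β; t,t',U,μ,h)` (`varPressure_hubbardZeeman_neg`, `varPressure_gcInteractionTT'_neg`).
* §4 **BOUND ON SPONTANEOUS MAGNETISATION**: for every translation-invariant equilibrium state `ω` at zero field (`β > 0`, `R ≥ 1`, `d ≥ 1`) and
  every `δ > 0`, `|ρ_↑(ω) − ρ_↓(ω)| ≤ (P(θ + δe₁) − P(θ))/(βδ)` (`IsVarEquilibrium.abs_spinPolarisation_le`, `…_gcInteractionTT'`), the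
  equilibrium set at zero field is spin-flip symmetric, and **FERROMAGNETIC ORDER IMPLIES COEXISTENCE**
  (`exists_ne_isVarEquilibrium_of_spinPolarisation_ne_zero`).

Everything is PROVED; definition with body: `hubbardZeeman`. No named fact, no number. HONEST SCOPE: no claim on whether order occurs.

## Tree / Mathlib search

REUSED: `FermionInteraction.spinFlip`, `varPressure_spinFlip`, `relabel_spinSwap_numberInteraction` (`StaggeredMagnetisationSpinFlipBound`);
`entropyDensitySup_spinFlip` (`SpinFlippedStatesStaggeredOrderCoexistence`); `InfVolFermionState.spinFlip`, `spinFlip_expect(_nAt)`,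
`fermionEmbed_relabel_spinSwap`, `relabel_spinSwap_relabel_spinSwap`, `relabel_spinSwap_nAt/_cAt`, `relabel_spinSwap_hubbardΦ`, `IsTranslationInvariant.spinFlip`
(`InfVolFermionStateSpinFlip`); `meanEnergyObs`, `meanEnergy`, `meanEnergy_spinImbalanceInteraction`; `IsVarEquilibrium(.meanEnergy_mem_Icc)`
(`TIVariationalPressure`, `VariationalEquilibriumCoexistence`); `gcInteractionTT'(_isHermitian/_isEven/_isTranslationInvariant/_hasFiniteRange)`
(`FermionGibbsVariationalPrinciple`); `diagHoppingFermionInteraction`, `hubbardTTPrimeFermionInteraction_apply` (`HubbardNNNHoppingInteraction`).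

## References

* R. B. Griffiths, J. Math. Phys. 5 (1964) 1215, Eq. (39) (magnetisation from pressure differences).
* R. B. Israel, *Convexity in the Theory of Lattice Gases* (1979), Thm. I.2.4, §IV.2.
* G. Benfatto, A. Giuliani, V. Mastropietro, Ann. Henri Poincaré 7 (2006) 809, §2.1 (spin exchange symmetry of the Hubbard model).
-/

noncomputable section

open scoped ComplexOrder BigOperators
open Finset Filter Topology

namespace Literature.MathematicalPhysics.QuantumLattice

open Matrix HubbardWave0 Literature.Probability.LatticeModels ThermodynamicLimit

variable {d : ℕ}

/-! ### §1. Mean energies under the spin exchange; odd and invariant atoms -/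

namespace FermionInteraction

variable (Ψ : FermionInteraction d)

/-- **`E_{Ψ^swap} = Γ_swap(E_Ψ)`** (the mean-energy observable of the flipped interaction). [cite: BratteliKishimotoRobinson1978, §3 (mean energy functional)] -/
theorem spinFlip_meanEnergyObs (R : ℝ) :
    Ψ.spinFlip.meanEnergyObs R =
      relabel (Orb.spinSwap : Orb (PolySite (thicken ({0} : Finset (Site d)) R)) ≃ Orb (PolySite (thicken ({0} : Finset (Site d)) R)))
        (Ψ.meanEnergyObs R) := by
  unfold meanEnergyObs
  rw [map_sum]
  refine Finset.sum_congr rfl fun X _ => ?_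
  rw [map_smul, ← fermionEmbed_relabel_spinSwap]
  rfl

/-- `Ψ^swap^swap = Ψ`. [cite: BenfattoGiulianiMastropietro2006, §2.1] -/
theorem spinFlip_spinFlip : Ψ.spinFlip.spinFlip = Ψ :=
  FermionInteraction.ext fun X => by rw [spinFlip_apply, spinFlip_apply, relabel_spinSwap_relabel_spinSwap]

end FermionInteraction

namespace InfVolFermionState

variable (ω : InfVolFermionState d)

/-- **`e_Ψ(ω ∘ Γ) = e_{Ψ^swap}(ω)`.** [cite: BratteliKishimotoRobinson1978, §3 (mean energy functional)] -/
theorem meanEnergy_spinFlip (Ψ : FermionInteraction d) (R : ℝ) : ω.spinFlip.meanEnergy Ψ R = ω.meanEnergy Ψ.spinFlip R := by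
  rw [meanEnergy, meanEnergy, spinFlip_expect, Ψ.spinFlip_meanEnergyObs]

/-- `e_{Ψ^swap}(ω ∘ Γ) = e_Ψ(ω)`. [cite: BratteliKishimotoRobinson1978, §3] -/
theorem meanEnergy_spinFlip_spinFlip (Ψ : FermionInteraction d) (R : ℝ) : ω.spinFlip.meanEnergy Ψ.spinFlip R = ω.meanEnergy Ψ R := by
  rw [meanEnergy_spinFlip, Ψ.spinFlip_spinFlip]

/-- **The spin polarisation is odd**: `e_s(ω ∘ Γ) = −e_s(ω)` (`e_s = ρ_↑ − ρ_↓`, `meanEnergy_spinImbalanceInteraction`). [cite: ArakiMoriya2003, §4.1] -/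
theorem meanEnergy_spinImbalanceInteraction_spinFlip (R : ℝ) :
    ω.spinFlip.meanEnergy (spinImbalanceInteraction d) R = -ω.meanEnergy (spinImbalanceInteraction d) R := by
  rw [meanEnergy_spinImbalanceInteraction, meanEnergy_spinImbalanceInteraction, spinFlip_expect_nAt, spinFlip_expect_nAt,
    Equiv.swap_apply_left, Equiv.swap_apply_right, neg_sub]

end InfVolFermionState

/-- **The spin-imbalance term is ODD under spin exchange**: `Γ_swap(Φ_s X) = −Φ_s X`. [cite: BenfattoGiulianiMastropietro2006, §2.1] -/
theorem relabel_spinSwap_spinImbalanceInteraction (X : Finset (Site d)) :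
    relabel (Orb.spinSwap : Orb (PolySite X) ≃ Orb (PolySite X)) ((spinImbalanceInteraction d).Φ X) = -(spinImbalanceInteraction d).Φ X := by
  have hn : ∀ (x : Site d) (hx : x ∈ X), nAt x hx 1 - nAt x hx 0 = -(nAt x hx 0 - nAt x hx 1) := fun x hx => (neg_sub _ _).symm
  simp only [spinImbalanceInteraction, map_sum, apply_ite (relabel (Orb.spinSwap : Orb (PolySite X) ≃ Orb (PolySite X))), map_zero, map_sub,
    InfVolFermionState.relabel_spinSwap_nAt, Equiv.swap_apply_left, Equiv.swap_apply_right, hn, ← Finset.sum_neg_distrib, neg_ite, neg_zero]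

/-- **The diagonal (`t'`) hopping is spin-exchange invariant.** [cite: BenfattoGiulianiMastropietro2006, §2.1] -/
theorem relabel_spinSwap_diagHoppingFermionInteraction (t' : ℝ) (X : Finset (Site 2)) :
    relabel (Orb.spinSwap : Orb (PolySite X) ≃ Orb (PolySite X)) ((diagHoppingFermionInteraction t').Φ X) = (diagHoppingFermionInteraction t').Φ X := by
  have hc : ∀ (x y : Site 2) (hx : x ∈ X) (hy : y ∈ X),
      (cAt x hx (1 : Fin 2))ᴴ * cAt y hy 1 + (cAt y hy (1 : Fin 2))ᴴ * cAt x hx 1 + ((cAt x hx (0 : Fin 2))ᴴ * cAt y hy 0 + (cAt y hy (0 : Fin 2))ᴴ * cAt x hx 0) =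
        (cAt x hx (0 : Fin 2))ᴴ * cAt y hy 0 + (cAt y hy (0 : Fin 2))ᴴ * cAt x hx 0 + ((cAt x hx (1 : Fin 2))ᴴ * cAt y hy 1 + (cAt y hy (1 : Fin 2))ᴴ * cAt x hx 1) :=
    fun x y hx hy => add_comm _ _
  simp only [diagHoppingFermionInteraction, map_sum, apply_ite (relabel (Orb.spinSwap : Orb (PolySite X) ≃ Orb (PolySite X))), map_zero, map_smul,
    map_add, map_mul, relabel_conjTranspose, InfVolFermionState.relabel_spinSwap_cAt, Equiv.swap_apply_left, Equiv.swap_apply_right,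
    Fin.sum_univ_two, hc]

/-- **The `t–t'` Hubbard interaction is spin-exchange invariant.** [cite: BenfattoGiulianiMastropietro2006, §2.1] -/
theorem relabel_spinSwap_hubbardTTPrimeFermionInteraction (t t' U : ℝ) (X : Finset (Site 2)) :
    relabel (Orb.spinSwap : Orb (PolySite X) ≃ Orb (PolySite X)) ((hubbardTTPrimeFermionInteraction t t' U).Φ X) =
      (hubbardTTPrimeFermionInteraction t t' U).Φ X := by
  rw [hubbardTTPrimeFermionInteraction_apply, map_add, InfVolFermionState.relabel_spinSwap_hubbardΦ, relabel_spinSwap_diagHoppingFermionInteraction]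

/-- **Spin exchange reverses a uniform field**: for a spin-exchange-invariant base `Ψ₀`,
`(Ψ₀ + θ₀ n + θ₁ s)^swap = Ψ₀ + θ₀ n − θ₁ s`. [cite: BenfattoGiulianiMastropietro2006, §2.1] -/
theorem spinFlip_linearFamily_number_spin {Ψ₀ : FermionInteraction d}
    (h0 : ∀ X : Finset (Site d), relabel (Orb.spinSwap : Orb (PolySite X) ≃ Orb (PolySite X)) (Ψ₀.Φ X) = Ψ₀.Φ X) (θ : Fin 2 → ℝ) :
    (FermionInteraction.linearFamily Ψ₀ ![numberInteraction d, spinImbalanceInteraction d] θ).spinFlip =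
      FermionInteraction.linearFamily Ψ₀ ![numberInteraction d, spinImbalanceInteraction d] ![θ 0, -θ 1] := by
  refine FermionInteraction.ext fun X => ?_
  rw [FermionInteraction.spinFlip_apply, FermionInteraction.linearFamily_apply, FermionInteraction.linearFamily_apply, Fin.sum_univ_two,
    Fin.sum_univ_two, map_add, map_add, map_smul, map_smul]
  simp only [Matrix.cons_val_zero, Matrix.cons_val_one]
  rw [h0, relabel_spinSwap_numberInteraction, relabel_spinSwap_spinImbalanceInteraction, Complex.ofReal_neg, neg_smul, smul_neg]

/-! ### §2. Translation-invariant equilibrium states under the spin flip -/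

namespace InfVolFermionState

variable {β R : ℝ} {Ψ : FermionInteraction d} {ω : InfVolFermionState d}

/-- **The spin flip carries translation-invariant equilibrium states of `Ψ` to those of `Ψ^swap`** (`d ≥ 1`; `Ψ` Hermitian, even, translation
covariant, of finite range `R`). [cite: Israel1979, Thm. I.2.4] [cite: BratteliRobinsonII1997, Prop. 6.2.15] -/
theorem IsVarEquilibrium.spinFlip (hd : 0 < d) (hH : Ψ.IsHermitian) (hE : Ψ.IsEven) (hT : Ψ.IsTranslationInvariant) (hR : Ψ.HasFiniteRange R)
    (h : ω.IsVarEquilibrium β Ψ R) : ω.spinFlip.IsVarEquilibrium β Ψ.spinFlip R := by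
  refine ⟨h.1.spinFlip, ?_⟩
  rw [entropyDensitySup_spinFlip, meanEnergy_spinFlip_spinFlip, FermionInteraction.varPressure_spinFlip hd hH hE hT hR]
  exact h.2

end InfVolFermionState

/-! ### §3. The Hubbard model in a uniform field; the `t–t'` model -/

/-- **The Hubbard model in a chemical potential and a UNIFORM field** as a linear family: `Ψ(θ) = Φ^{t,U} + θ₀ n + θ₁ s` (`θ = (−μ, −h)`).
[cite: KomaTasaki1994, §1] -/
def hubbardZeeman (d : ℕ) (t U : ℝ) (θ : Fin 2 → ℝ) : FermionInteraction d :=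
  FermionInteraction.linearFamily (hubbardFermionInteraction d t U) ![numberInteraction d, spinImbalanceInteraction d] θ

/-- Structure: Hermitian, even, translation covariant, range `1`. [cite: ArakiMoriya2003, §1 assumptions (II), (IV) and §5.4] -/
theorem hubbardZeeman_structure (t U : ℝ) (θ : Fin 2 → ℝ) :
    (hubbardZeeman d t U θ).IsHermitian ∧ (hubbardZeeman d t U θ).IsEven ∧ (hubbardZeeman d t U θ).IsTranslationInvariant ∧
      (hubbardZeeman d t U θ).HasFiniteRange 1 :=
  ⟨FermionInteraction.isHermitian_linearFamily (hubbardFermionInteraction_isHermitian t U)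
      (fun a => by fin_cases a <;> [exact numberInteraction_isHermitian; exact spinImbalanceInteraction_isHermitian]) _,
    FermionInteraction.isEven_linearFamily (hubbardFermionInteraction_isEven t U)
      (fun a => by fin_cases a <;> [exact numberInteraction_isEven; exact spinImbalanceInteraction_isEven]) _,
    FermionInteraction.isTranslationInvariant_linearFamily (hubbardFermionInteraction_isTranslationInvariant t U)
      (fun a => by fin_cases a <;> [exact numberInteraction_isTranslationInvariant; exact spinImbalanceInteraction_isTranslationInvariant]) _,
    FermionInteraction.hasFiniteRange_linearFamily (hubbardFermionInteraction_hasFiniteRange t U)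
      (fun a => by fin_cases a <;> [exact numberInteraction_hasFiniteRange 1 zero_le_one; exact spinImbalanceInteraction_hasFiniteRange 1 zero_le_one]) _⟩

/-- `(Ψ^{t,U}(θ₀, θ₁))^swap = Ψ^{t,U}(θ₀, −θ₁)`. [cite: BenfattoGiulianiMastropietro2006, §2.1] -/
theorem spinFlip_hubbardZeeman (t U : ℝ) (θ : Fin 2 → ℝ) : (hubbardZeeman d t U θ).spinFlip = hubbardZeeman d t U ![θ 0, -θ 1] :=
  spinFlip_linearFamily_number_spin (InfVolFermionState.relabel_spinSwap_hubbardΦ t U) θ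

/-- `(gc t–t' interaction at field h)^swap = the same at field −h`. [cite: BenfattoGiulianiMastropietro2006, §2.1] -/
theorem spinFlip_gcInteractionTT' (t t' U μ hz : ℝ) : (gcInteractionTT' t t' U μ hz).spinFlip = gcInteractionTT' t t' U μ (-hz) := by
  rw [gcInteractionTT', gcInteractionTT', spinFlip_linearFamily_number_spin (relabel_spinSwap_hubbardTTPrimeFermionInteraction t t' U)]
  simp only [Matrix.cons_val_zero, Matrix.cons_val_one]

/-- **THE PRESSURE IS EVEN IN THE UNIFORM FIELD** (Hubbard model, any `d ≥ 1`, every real `β`, `R ≥ 1`): `P(β; a, −b) = P(β; a, b)`.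
[cite: Israel1979, Thm. I.2.4] [cite: BenfattoGiulianiMastropietro2006, §2.1] -/
theorem varPressure_hubbardZeeman_neg (hd : 0 < d) (t U a b β : ℝ) {R : ℝ} (hR : 1 ≤ R) :
    (hubbardZeeman d t U ![a, -b]).varPressure β R = (hubbardZeeman d t U ![a, b]).varPressure β R := by
  obtain ⟨hH, hE, hT, hR1⟩ := hubbardZeeman_structure (d := d) t U ![a, b]
  have hRR : (hubbardZeeman d t U ![a, b]).HasFiniteRange R := fun X hX => hR1 X (lt_of_le_of_lt hR hX)
  have h := FermionInteraction.varPressure_spinFlip hd hH hE hT hRR β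
  rw [spinFlip_hubbardZeeman] at h
  simpa only [Matrix.cons_val_zero, Matrix.cons_val_one] using h

/-- **The `t–t'` pressure is even in the field**: `P(β; t,t',U,μ,−h) = P(β; t,t',U,μ,h)` (every real `β`, `R ≥ 1`).
[cite: Israel1979, Thm. I.2.4] [cite: BenfattoGiulianiMastropietro2006, §2.1] -/
theorem varPressure_gcInteractionTT'_neg (t t' U μ hz β : ℝ) {R : ℝ} (hR : 1 ≤ R) :
    (gcInteractionTT' t t' U μ (-hz)).varPressure β R = (gcInteractionTT' t t' U μ hz).varPressure β R := by
  have hRR : (gcInteractionTT' t t' U μ hz).HasFiniteRange R := fun X hX => gcInteractionTT'_hasFiniteRange t t' U μ hz X (lt_of_le_of_lt hR hX)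
  have h := FermionInteraction.varPressure_spinFlip two_pos (gcInteractionTT'_isHermitian t t' U μ hz) (gcInteractionTT'_isEven t t' U μ hz)
    (gcInteractionTT'_isTranslationInvariant t t' U μ hz) hRR β
  rwa [spinFlip_gcInteractionTT'] at h

/-! ### §4. The bound on spontaneous magnetisation; ferromagnetic order implies coexistence -/

namespace InfVolFermionState

variable {β R t U a : ℝ} {ω : InfVolFermionState d}

/-- **BOUND ON SPONTANEOUS MAGNETISATION** (Hubbard model, zero field `θ = (a, 0)`, `β > 0`, `R ≥ 1`, `d ≥ 1`, every `δ > 0`): every translation-invariant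
equilibrium state has `|ρ_↑ − ρ_↓| ≤ (P(β; a, δ) − P(β; a, 0))/(βδ)`. [cite: Griffiths1964, Eq. (39) and Fig. 3] [cite: Israel1979, Thm. I.2.4] -/
theorem IsVarEquilibrium.abs_spinPolarisation_le (hd : 0 < d) (hβ : 0 < β) (hR : 1 ≤ R)
    (h : ω.IsVarEquilibrium β (hubbardZeeman d t U ![a, 0]) R) {δ : ℝ} (hδ : 0 < δ) :
    |ω.meanEnergy (spinImbalanceInteraction d) R| ≤
      ((hubbardZeeman d t U ![a, δ]).varPressure β R - (hubbardZeeman d t U ![a, 0]).varPressure β R) / (β * δ) := by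
  have h' : ω.IsVarEquilibrium β
      (FermionInteraction.linearFamily (hubbardFermionInteraction d t U) ![numberInteraction d, spinImbalanceInteraction d] ![a, 0]) R := h
  have hw := h'.meanEnergy_mem_Icc hβ 1 hδ
  have e1 : (![a, 0] : Fin 2 → ℝ) + Pi.single 1 δ = ![a, δ] := by
    funext i
    fin_cases i <;> simp
  have e2 : (![a, 0] : Fin 2 → ℝ) + Pi.single 1 (-δ) = ![a, -δ] := by
    funext i
    fin_cases i <;> simp
  rw [e1, e2, show (![numberInteraction d, spinImbalanceInteraction d] : Fin 2 → FermionInteraction d) 1 = spinImbalanceInteraction d from rfl] at hw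
  change ω.meanEnergy (spinImbalanceInteraction d) R ∈ Set.Icc
      (((hubbardZeeman d t U ![a, 0]).varPressure β R - (hubbardZeeman d t U ![a, δ]).varPressure β R) / (β * δ))
      (((hubbardZeeman d t U ![a, -δ]).varPressure β R - (hubbardZeeman d t U ![a, 0]).varPressure β R) / (β * δ)) at hw
  rw [varPressure_hubbardZeeman_neg hd t U a δ β hR] at hw
  rw [abs_le, ← neg_div, neg_sub]
  exact ⟨hw.1, hw.2⟩

/-- The same for the `t–t'` Hubbard model on `ℤ²` (zero field, `β > 0`, `R ≥ 1`): `|ρ_↑ − ρ_↓| ≤ (P(h = −δ) − P(h = 0))/(βδ)` in the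
convention `gcInteractionTT' t t' U μ h = Φ − μ n − h s`. [cite: Griffiths1964, Eq. (39) and Fig. 3] -/
theorem IsVarEquilibrium.abs_spinPolarisation_le_gcInteractionTT' (hβ : 0 < β) (hR : 1 ≤ R) {t' μ : ℝ} {ω : InfVolFermionState 2}
    (h : ω.IsVarEquilibrium β (gcInteractionTT' t t' U μ 0) R) {δ : ℝ} (hδ : 0 < δ) :
    |ω.meanEnergy (spinImbalanceInteraction 2) R| ≤
      ((gcInteractionTT' t t' U μ (-δ)).varPressure β R - (gcInteractionTT' t t' U μ 0).varPressure β R) / (β * δ) := by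
  have h' : ω.IsVarEquilibrium β
      (FermionInteraction.linearFamily (hubbardTTPrimeFermionInteraction t t' U) ![numberInteraction 2, spinImbalanceInteraction 2] ![-μ, -0]) R := h
  have hw := h'.meanEnergy_mem_Icc hβ 1 hδ
  have e1 : (![-μ, -0] : Fin 2 → ℝ) + Pi.single 1 δ = ![-μ, -(-δ)] := by
    funext i
    fin_cases i <;> simp
  have e2 : (![-μ, -0] : Fin 2 → ℝ) + Pi.single 1 (-δ) = ![-μ, -δ] := by
    funext i
    fin_cases i <;> simp
  rw [e1, e2, show (![numberInteraction 2, spinImbalanceInteraction 2] : Fin 2 → FermionInteraction 2) 1 = spinImbalanceInteraction 2 from rfl] at hw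
  change ω.meanEnergy (spinImbalanceInteraction 2) R ∈ Set.Icc
      (((gcInteractionTT' t t' U μ 0).varPressure β R - (gcInteractionTT' t t' U μ (-δ)).varPressure β R) / (β * δ))
      (((gcInteractionTT' t t' U μ δ).varPressure β R - (gcInteractionTT' t t' U μ 0).varPressure β R) / (β * δ)) at hw
  rw [← varPressure_gcInteractionTT'_neg t t' U μ δ β hR] at hw
  rw [abs_le, ← neg_div, neg_sub]
  exact ⟨hw.1, hw.2⟩

/-- `Ψ^{t,U}(a, 0)` is its own spin flip. [cite: BenfattoGiulianiMastropietro2006, §2.1] -/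
theorem _root_.Literature.MathematicalPhysics.QuantumLattice.spinFlip_hubbardZeeman_zero (t U a : ℝ) :
    (hubbardZeeman d t U ![a, 0]).spinFlip = hubbardZeeman d t U ![a, 0] := by
  rw [spinFlip_hubbardZeeman]
  simp only [Matrix.cons_val_zero, Matrix.cons_val_one, neg_zero]

/-- **At zero field the set of translation-invariant equilibrium states is spin-flip symmetric** (`R ≥ 1`, `d ≥ 1`). [cite: Israel1979, Thm. I.2.4] -/
theorem IsVarEquilibrium.spinFlip_hubbardZeeman_zero (hd : 0 < d) (hR : 1 ≤ R) (h : ω.IsVarEquilibrium β (hubbardZeeman d t U ![a, 0]) R) :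
    ω.spinFlip.IsVarEquilibrium β (hubbardZeeman d t U ![a, 0]) R := by
  obtain ⟨hH, hE, hT, hR1⟩ := hubbardZeeman_structure (d := d) t U ![a, 0]
  have hRR : (hubbardZeeman d t U ![a, 0]).HasFiniteRange R := fun X hX => hR1 X (lt_of_le_of_lt hR hX)
  have h' := h.spinFlip hd hH hE hT hRR
  rwa [Literature.MathematicalPhysics.QuantumLattice.spinFlip_hubbardZeeman_zero] at h'

/-- **FERROMAGNETIC ORDER IMPLIES COEXISTENCE**: a translation-invariant equilibrium state of the zero-field Hubbard model with `ρ_↑ ≠ ρ_↓`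
comes with a second, different equilibrium state `ω ∘ Γ_swap` of opposite polarisation. [cite: Israel1979, Thm. I.2.4] -/
theorem exists_ne_isVarEquilibrium_of_spinPolarisation_ne_zero (hd : 0 < d) (hR : 1 ≤ R)
    (h : ω.IsVarEquilibrium β (hubbardZeeman d t U ![a, 0]) R) (hm : ω.meanEnergy (spinImbalanceInteraction d) R ≠ 0) :
    ∃ ω' : InfVolFermionState d, ω'.IsVarEquilibrium β (hubbardZeeman d t U ![a, 0]) R ∧ ω' ≠ ω ∧
      ω'.meanEnergy (spinImbalanceInteraction d) R = -ω.meanEnergy (spinImbalanceInteraction d) R := by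
  refine ⟨ω.spinFlip, h.spinFlip_hubbardZeeman_zero hd hR, fun heq => hm ?_, ω.meanEnergy_spinImbalanceInteraction_spinFlip R⟩
  have h1 := ω.meanEnergy_spinImbalanceInteraction_spinFlip R
  rw [heq] at h1
  linarith

end InfVolFermionState

end Literature.MathematicalPhysics.QuantumLattice

end
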